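import Summits.QuantumFields.BalabanUV.T4Continuum.Support.NE9EndApplied
import Summits.QuantumFields.BalabanUV.T4Continuum.Support.NE9ChartFamilyPullback

/-!
# NE9EndAppliedRealRow — THE END OF RECORD, APPLIED (p223763), READ AT THE REAL ROW: one complex chart per real background `U`,
# the END's hypotheses PER CHART with BACKGROUND-UNIFORM LETTERS, the real functional = the defined functional of the chart at
# `U` read at the chart's base point on the `re` copy — `TermSize ∧ NE9 ∧ FadingMemory` for a functional on REAL backgrounds
# (cell `pub-balaban`, T4-DAG §2 node U3 ∕ §6 NE9; BINDER row NE9 OWNER lineage `b2b-balaban-t4-ne9-p1`, generation 33;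
# CARVER-NOTES g32 §4 (3) «p223763 per background + real row p220529»)

HONEST FRAMING (T4-DAG PAGE 1).  Rung (B)+1 of the FINITE-VOLUME T⁴ programme — NOT infinite volume, NOT a mass gap, NOT the
Clay problem.  NE9 (`T4OutputRate.NE9` ∧ `FadingMemory`) is a cell NEW ESTIMATE, NOT PRINTED in [I] = [Balaban1987RG1]
(CMP **109**), [II] = [Balaban1988RG2Cluster] (CMP **116**), and NOT PROVED for Bałaban's E^{(j)} («NE9 ⇐ the named binders»;
0∕18 leaves instantiated on Bałaban's objects; spine PROVED 0∕9).  HONEST DEPENDENCY (cell line, verbatim): continuum YM on T⁴ ⇐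
BetaPertH ∧ nine spine estimates (0/9 proved); BetaPertH ⇐ (D1) ∧ (D4) ∧ CAP+tail; G-an2-4 gates asym, D1 and NE2/3/4.
`FlowStep.BetaPertH`, (B), (B^μ) do not occur.  One DATA def (`EreOf`, the real-row functional) and ONE composition BY NAME of
p223763 with p220529; no estimate of any object of the series; quotations for TYPES only (ABSOLUTE RULE).  0 sorry.

WHAT.  The consumer of row NE9 (node U3; NE4's read-out) wants `NE9 E W κ Λ` for a functional `E : Functional C₀ Bg` on REAL
backgrounds `Bg`.  The END of record is typed on a COMPLEX chart `E` (WALL-NE9-P1 §3 (vi)); `NE9ChartFamilyPullback` (p220529)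
reads the real row from a FAMILY of charts, one per real background, at base points; `NE9EndApplied` (p223763) applies the END to
the recursion-defined functional `EfOf …` on one chart.  THIS FILE is their composition, the row's END IN CONSUMER CURRENCY:
* §1 DATA **`EreOf`** — the real-row functional `g U X ↦ EfOf G (act U) (wt U) (U₀ U) (explZ U) (base U) (𝒯 U) (P U) g (pt U) (X, re)`
  of a chart family (all charts in one ambient complex space `E`, as the substrate's `TowerData P o`; per background `U`: the
  activities `act U` — at the chart face `actChart S raw (towerPairChart (towerDataOf U) ρ) (iRecC …)`, p221235∕p224660 —, the
  vacuum point, explicit part, scale-0 datum, channel and projection; base point `pt U`, = `0` for the tower pair chart);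
* §2 **`termSize_ne9_and_fadingMemory_realRow`** — hypotheses = those of `NE9EndApplied.termSize_ne9_and_fadingMemory_endApplied`
  with every MODEL datum a family over `Bg` (species data `D U`, `K U`, activities `act U`, majorants `n U`, admissible classes
  `Adm U ⊇ MF U`, read-out `r U`, marginal direction `A U`, vacuum point `U₀ U`, explicit part, scale-0 datum) and every LETTER
  background-UNIFORM (`κ, B, lipbar, clipbar, qTbar, ω, cr, aA, Nbar, clipa, lam, p₀, N, cdir, cK, …` — the uniformity [I] Thm 1
  p. 259 ∕ (1.18) p. 263 print for the bounds themselves: constants independent of the background), conclusion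
  `TermSize (EreOf …) W κ N ∧ NE9 (EreOf …) W κ Λ ∧ FadingMemory (ℓ∕ω′) ω′ Λ` with the END of record's `Λ = prodModuli ℓ (fun _ ↦ ω′)`,
  `ℓ = 8·clipbar·B + 8·lipbar·B·qTbar`, `ω′ = ω + 8·lipbar·B·(1 + cr·aA)·(cQa + cQb)` — LETTER FOR LETTER the END's, now for a
  functional on real backgrounds.  Proof: `termSize_ne9_fading_re_of_chartFamily` ∘ (`termSize_ne9_and_fadingMemory_endApplied` per `U`).
WHAT STAYS DISPLAYED (unchanged classes, WALL §2, per chart): species data + `Admissible` (S5, T), counts, MF∕`hAdm` (T), A1∕A2 on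
`admOf` (T∕K per `NE9ChartFaceActivitySecant`), A3, G1∕G2, N1∕N2, RO∕AW, `hexplZ`, `hbase0`.  DISGUISE TEST: a composition; the
per-chart hypotheses ARE the END's; nothing of Bałaban's is asserted; not NE9 for Bałaban's E^{(j)} (O-NE9-1).

References (TYPES ∕ loci only): [Balaban1987RG1] T. Bałaban, CMP **109** (1987) 249–301, Thm 1 p. 259, (1.18) p. 263, (2.13)–(2.14)
p. 268; [Balaban1988RG2Cluster] T. Bałaban, CMP **116** (1988) 1–22, (1.33)–(1.36) p. 9; [Balaban1985BackgroundPropagators] T. Bałaban,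
CMP **99** (1985) 389–434, Sect. B pp. 399–400.  Summits-side NEW work (LEAN PLACEMENT RULE); imports p223763 and p220529 BY NAME;
modifies nothing.  Value = the row's END in the consumer's currency, NOT summit progress.
-/

noncomputable section

namespace Summit.QuantumFields.BalabanUV.T4Continuum.NE9EndAppliedRealRow

open scoped BigOperators ENNReal
open Metric Set
open Literature.Probability.LatticeModels
open Literature.MathematicalPhysics.QuantumFieldTheory.Balaban1983to89
open Literature.MathematicalPhysics.QuantumFieldTheory.Balaban1983to89.T4OutputRate
open Literature.MathematicalPhysics.QuantumFieldTheory.Balaban1983to89.T4HistoryLipschitzRecursion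
open Literature.MathematicalPhysics.QuantumFieldTheory.Balaban1983to89.T4HistoryLipschitzOuter
open Literature.MathematicalPhysics.QuantumFieldTheory.Balaban1983to89.T4HistoryLipschitzActivity
open Literature.MathematicalPhysics.QuantumFieldTheory.Balaban1983to89.T4HistoryLipschitzActivity (ClusterGeom)
open Literature.MathematicalPhysics.QuantumFieldTheory.Balaban1983to89.T4HistoryLipschitzSegment
open Summit.QuantumFields.BalabanUV.T4Continuum.NE9Lemma1Counting
open Summit.QuantumFields.BalabanUV.T4Continuum.NE9Lemma1Gain
open Summit.QuantumFields.BalabanUV.T4Continuum.NE9Lemma1PieceClass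
open Summit.QuantumFields.BalabanUV.T4Continuum.NE9Lemma1RemainderSpecies
open Summit.QuantumFields.BalabanUV.T4Continuum.NE9Lemma1CurveSpecies
open Summit.QuantumFields.BalabanUV.T4Continuum.NE9Lemma1KernelSpecies
open Summit.QuantumFields.BalabanUV.T4Continuum.NE9ComplexEncoding (doubleCarriers)
open Summit.QuantumFields.BalabanUV.T4Continuum.NE9MarginalProjection
open Summit.QuantumFields.BalabanUV.T4Continuum.NE9MarginalProjectionEnd
open Summit.QuantumFields.BalabanUV.T4Continuum.NE9ChannelSum
open Summit.QuantumFields.BalabanUV.T4Continuum.NE9SizeFedCoupling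
open Summit.QuantumFields.BalabanUV.T4Continuum.NE9TableReading
open Summit.QuantumFields.BalabanUV.T4Continuum.NE9RecursionFunctional
open Summit.QuantumFields.BalabanUV.T4Continuum.NE9EndApplied
open Summit.QuantumFields.BalabanUV.T4Continuum.NE9ChartFamilyPullback

variable {C₀ : Carriers} {Bg : Type} {E : Type} [NormedAddCommGroup E] [NormedSpace ℂ E]
  {ι α β γ δ α' β' γ' δ' Pt : Type} [DecidableEq δ] [DecidableEq δ']

/-! ## §1 The real-row functional of a chart family -/

/-- [folklore] DATA: **THE REAL-ROW FUNCTIONAL OF A CHART FAMILY** — at the real background `U`, the recursion-defined functional of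
the chart at `U` (`NE9EndApplied.EfOf` with the per-background activities, weights, vacuum point, explicit part, scale-0 datum,
channel and projection) read at the base point `pt U` on the `re` copy of the doubled carriers.
[cite: Balaban1987RG1, (1.18) p.263 and (2.13)-(2.14) p.268; Balaban1985BackgroundPropagators, Sect. B pp.399-400] -/
def EreOf (G : ClusterGeom (doubleCarriers C₀)) (act : Bg → ℕ → ℝ → E → lp (fun _ : ι => ℂ) ∞ → G.P → ℂ)
    (wt : Bg → ℕ → ι → ℝ) (U₀ : Bg → E) (explZ : Bg → ℕ → E → (doubleCarriers C₀).Dom → ℝ)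
    (base : Bg → E → (doubleCarriers C₀).Dom → ℝ)
    (𝒯 : Bg → ℕ → (ℕ → ℝ) → (E → (doubleCarriers C₀).Dom → ℝ) → ι → ℝ)
    (P : Bg → (E → (doubleCarriers C₀).Dom → ℝ) → (E → (doubleCarriers C₀).Dom → ℝ)) (pt : Bg → E) : Functional C₀ Bg :=
  fun g U X => EfOf G (act U) (wt U) (U₀ U) (explZ U) (base U) (𝒯 U) (P U) g (pt U) (X, true)

omit [NormedAddCommGroup E] [NormedSpace ℂ E] in
/-- [folklore] `EreOf` unfolds. -/
theorem EreOf_apply (G : ClusterGeom (doubleCarriers C₀)) (act : Bg → ℕ → ℝ → E → lp (fun _ : ι => ℂ) ∞ → G.P → ℂ)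
    (wt : Bg → ℕ → ι → ℝ) (U₀ : Bg → E) (explZ : Bg → ℕ → E → (doubleCarriers C₀).Dom → ℝ)
    (base : Bg → E → (doubleCarriers C₀).Dom → ℝ)
    (𝒯 : Bg → ℕ → (ℕ → ℝ) → (E → (doubleCarriers C₀).Dom → ℝ) → ι → ℝ)
    (P : Bg → (E → (doubleCarriers C₀).Dom → ℝ) → (E → (doubleCarriers C₀).Dom → ℝ)) (pt : Bg → E) (g : ℕ → ℝ) (U : Bg)
    (X : C₀.Dom) :
    EreOf G act wt U₀ explZ base 𝒯 P pt g U X = EfOf G (act U) (wt U) (U₀ U) (explZ U) (base U) (𝒯 U) (P U) g (pt U) (X, true) :=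
  rfl

/-! ## §2 The END of record in the consumer's currency -/

/-- **THE END OF RECORD APPLIED, REAL ROW.**  For a chart family indexed by the real backgrounds `U : Bg` (all charts in `E`), with
the END's MODEL data per chart and its LETTERS background-uniform, the hypotheses of `NE9EndApplied.termSize_ne9_and_fadingMemory_endApplied`
at every `U` give, for the real-row functional `EreOf …` (§1), `TermSize ∧ NE9 ∧ FadingMemory` with the END of record's letters —
`NE9ChartFamilyPullback.termSize_ne9_fading_re_of_chartFamily` ∘ (the END per chart).  `U₁` is any background (to read the
background-free fading clause). [cite: Balaban1987RG1, Thm 1 p.259, (0.23) p.256, (1.18) p.263, (1.20)-(1.22) p.264, (2.13)-(2.14) p.268; Balaban1988RG2Cluster, (1.23)-(1.29) pp.7-8, (1.33)-(1.36) p.9, (2.14)-(2.15) p.15] -/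
theorem termSize_ne9_and_fadingMemory_realRow [Nonempty ι] (G : ClusterGeom (doubleCarriers C₀)) (U₁ : Bg) (pt : Bg → E)
    {D : Bg → CurData C₀ E ι α β γ δ} {K : Bg → KerData C₀ E ι α' β' γ' δ' Pt}
    {ℓg ℓk gain : ℕ → ℕ → ℝ} {cdir cK δ₀ δ₁ w w0 c0 c1 d0 O1 cQa cQb : ℝ} {W : Set (ℕ → ℝ)}
    {Adm MF : Bg → Set (E → (doubleCarriers C₀).Dom → ℝ)}
    {r : Bg → ℕ → (E → (doubleCarriers C₀).Dom → ℝ) → ℝ} {A : Bg → E → (doubleCarriers C₀).Dom → ℝ}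
    {act : Bg → ℕ → ℝ → E → lp (fun _ : ι => ℂ) ∞ → G.P → ℂ}
    {n : Bg → ℕ → ℝ → E → G.P → ℝ} {lip clip : ℕ → ℝ} {a d : G.P → ℝ} {δv : (doubleCarriers C₀).Dom → ℝ}
    {κ B lipbar clipbar qTbar ω cr aA Nbar clipa lam : ℝ} {p₀ N : ℕ → ℝ}
    -- species (a), per chart
    (hD : ∀ U, (D U).Admissible ℓg cdir d0) (hℓ : ∀ k j, 0 < ℓg k j)
    (hLa : ∀ U, LevelCountsG (D U).toC.frame κ (D U).κ₁ O1 cQa (fun k j => ℓg k j ^ 5) (agePow ω))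
    (hAa : ∀ U, PieceAdditiveOn (analyticClass (D U).R) (D U).toC)
    (hclipa : 0 ≤ clipa) (hcdir : 0 < cdir) (hhalf : ∀ k j, cdir * ℓg k j < 1 / 2)
    (hcont : ∀ U, ∀ (k : ℕ) (s : ℕ → ℝ) (y : ι) (a : α) (b : β) (x : (doubleCarriers C₀).Dom),
      ContinuousOn (fun q : (ℂ × ((δ → ℝ) × (δ → ℂ))) × ℂ => (D U).cur k s y a b x q.1.1 q.1.2.1 q.1.2.2 q.2)
        ((sphere (0:ℂ) ((D U).r k) ×ˢ {q | OnContour (D U).κ₁ ((D U).cubes k y a b) q.1 q.2}) ×ˢ sphere (0:ℂ) 1))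
    (hlip : ∀ U, ∀ g ∈ W, ∀ g' ∈ W, ∀ (k : ℕ) (y : ι), ∀ a ∈ (D U).S0 k y, ∀ b ∈ (D U).SY k y a, ∀ (j : ℕ),
      ∀ x ∈ (D U).src k y a j, ∀ t ∈ sphere (0:ℂ) ((D U).r k), ∀ (s' : δ → ℝ) (σ' : δ → ℂ),
        OnContour (D U).κ₁ ((D U).cubes k y a b) s' σ' → ∀ τ ∈ ball (0:ℂ) (1 / (2 * (cdir * ℓg k j))),
          ‖(D U).cur k g y a b x t s' σ' τ - (D U).cur k g' y a b x t s' σ' τ‖ ≤ clipa * ((D U).R x.1 / 2) * |g k - g' k|)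
    (hroom : ∀ U, ∀ g ∈ W, ∀ (k : ℕ) (y : ι), ∀ a ∈ (D U).S0 k y, ∀ b ∈ (D U).SY k y a, ∀ (j : ℕ), ∀ x ∈ (D U).src k y a j,
      ∀ t ∈ sphere (0:ℂ) ((D U).r k), ∀ (s' : δ → ℝ) (σ' : δ → ℂ), OnContour (D U).κ₁ ((D U).cubes k y a b) s' σ' →
        ∀ τ ∈ ball (0:ℂ) (1 / (2 * (cdir * ℓg k j))), ‖(D U).cur k g y a b x t s' σ' τ‖ ≤ (D U).R x.1 / 2)
    -- species (b), per chart
    (hK : ∀ U, (K U).Admissible ℓk gain cK δ₀ δ₁ w w0 c0 c1 d0) (hκ₁ : ∀ U, (K U).κ₁ = (D U).κ₁) (hR : ∀ U, (K U).R = (D U).R)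
    (hdY : ∀ U, (K U).toC.frame.dY = (D U).toC.frame.dY)
    (hLb : ∀ U, LevelCountsG (K U).toC.frame (κ - w) (K U).κ₁ O1 cQb gain (agePow ω))
    (hAb : ∀ U, PieceAdditiveOn (analyticClass (K U).R) (K U).toC) (hlam : 0 ≤ lam)
    (hkerC : ∀ U, ∀ (k : ℕ) (s : ℕ → ℝ) (y : ι) (a : α') (b : β') (x : (doubleCarriers C₀).Dom), ∀ p ∈ (K U).pts k y a,
      ∀ q ∈ (K U).pts k y a, ∀ F : E → ℂ, DifferentiableOn ℂ F (ball 0 ((K U).R x.1)) →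
        Continuous fun wv : ℂ × (δ' → ℝ) × (δ' → ℂ) => (K U).ker k s y a b x wv.1 wv.2.1 wv.2.2 p q F)
    (hkerL : ∀ U, ∀ g ∈ W, ∀ g' ∈ W, ∀ (k : ℕ) (y : ι), ∀ a ∈ (K U).S0 k y, ∀ b ∈ (K U).SY k y a, ∀ (j : ℕ),
      ∀ x ∈ (K U).src k y a j, ∀ t ∈ sphere (0:ℂ) ((K U).r k), ∀ (s' : δ' → ℝ) (σ' : δ' → ℂ),
        OnContour (K U).κ₁ ((K U).cubes k y a b) s' σ' → ∀ p ∈ (K U).pts k y a, ∀ q ∈ (K U).pts k y a, ∀ (F : E → ℂ) (M : ℝ),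
          DifferentiableOn ℂ F (ball 0 ((K U).R x.1)) → (∀ z ∈ ball (0:E) ((K U).R x.1), ‖F z‖ ≤ M) →
            ‖(K U).ker k g y a b x t s' σ' p q F - (K U).ker k g' y a b x t s' σ' p q F‖ ≤
              cK * lam * M * gain k j * (K U).ρd p q ^ (K U).m * Real.exp (-(δ₀ * ((K U).dX x.1 p + (K U).dX x.1 q))) *
                |g k - g' k|)
    (hO1 : 0 ≤ O1) (hcQa : 0 ≤ cQa) (hcQb : 0 ≤ cQb) (hMF : ∀ U, MF U ⊆ analyticClass (D U).R)
    -- the recursion data, per chart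
    (U₀ : Bg → E) (explZ : Bg → ℕ → E → (doubleCarriers C₀).Dom → ℝ) (base : Bg → E → (doubleCarriers C₀).Dom → ℝ)
    (hAdm : ∀ U, AdmissibleTerms (EfOf G (act U) (weightOf (D U).toC.frame (D U).κ₁ d0 O1 ((D U).Kp cdir + (K U).Kp cK w0 c0 c1))
      (U₀ U) (explZ U) (base U) (cpieceChannel (D U).toC + cpieceChannel (K U).toC) (margProj (r U) (A U))) W (Adm U))
    (hres : ∀ U, AdmRestrict (Adm U))
    (hrA : ∀ U, ReadAdditive (Adm U) (r U)) (hr0 : ∀ U, ReadZero (r U)) (hrs : ∀ U, ReadSize (Adm U) (r U) κ cr)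
    (hA : ∀ U, DirSize (A U) κ aA) (hcr : 0 ≤ cr) (haA : 0 ≤ aA) (hPinto : ∀ U, ProjInto (Adm U) (MF U) (margProj (r U) (A U)))
    (hclip0 : ∀ k, 0 ≤ clip k)
    (hCup : ∀ U, ∀ g ∈ W, ∀ g' ∈ W, ∀ (k : ℕ) (V : E) (X : (doubleCarriers C₀).Dom), (doubleCarriers C₀).scale X = k + 1 →
      ∀ Q ∈ admOf G (act U) (weightOf (D U).toC.frame (D U).κ₁ d0 O1 ((D U).Kp cdir + (K U).Kp cK w0 c0 c1)) (U₀ U) (explZ U)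
        (base U) (cpieceChannel (D U).toC + cpieceChannel (K U).toC) (margProj (r U) (A U)) W
        (fun k => sizeRadius (fun k j => (1 + cr * aA) * (tauOfG cQa (agePow ω) + tauOfG cQb (agePow ω)) k j) N k) k,
      ∀ γ' ∈ G.vol X,
        ‖act U k (g k) V Q γ'‖ ≤ n U k (g' k) V γ' ∧
          ‖act U k (g k) V Q γ' - act U k (g' k) V Q γ'‖ ≤ clip k * |g k - g' k| * n U k (g' k) V γ')
    (hclipb : ∀ k, clip k ≤ clipbar) (hNb : ∀ j, N j ≤ Nbar)
    (hqTb : (64 * clipa * cQa + lam * cQb) * ((1 + cr * aA) * Nbar) * (1 - ω)⁻¹ ≤ qTbar)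
    (hKP : ∀ U, TwoPointKP G W (act U) (admOf G (act U) (weightOf (D U).toC.frame (D U).κ₁ d0 O1 ((D U).Kp cdir + (K U).Kp cK w0 c0 c1))
      (U₀ U) (explZ U) (base U) (cpieceChannel (D U).toC + cpieceChannel (K U).toC) (margProj (r U) (A U)) W
      (fun k => sizeRadius (fun k j => (1 + cr * aA) * (tauOfG cQa (agePow ω) + tauOfG cQb (agePow ω)) k j) N k)) (n U) lip a d)
    (hdec : G.DecayExtract δv d) (hpin : G.PinBudget a δv (fun _ => B) κ)
    (hwt : ∀ U k y, 0 < weightOf (D U).toC.frame (D U).κ₁ d0 O1 ((D U).Kp cdir + (K U).Kp cK w0 c0 c1) k y)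
    (hexplZ : ∀ U, ∀ (k : ℕ) (V : E) (X : (doubleCarriers C₀).Dom), (doubleCarriers C₀).scale X = k + 1 →
      |explZ U k V X| ≤ Real.exp (-(κ * (doubleCarriers C₀).d X)) * p₀ k)
    (hbase0 : ∀ U, ∀ (V : E) (X : (doubleCarriers C₀).Dom), (doubleCarriers C₀).scale X = 0 →
      |base U V X| ≤ Real.exp (-(κ * (doubleCarriers C₀).d X)) * N 0)
    (hNsucc : ∀ j, p₀ j + 2 * B ≤ N (j + 1)) (hNnn : ∀ j, 0 ≤ N j)
    (hB : 0 ≤ B) (hlipb : ∀ k, lip k ≤ lipbar) (hω : 0 ≤ ω) (hω1 : ω < 1)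
    (hpos : 0 < ω + 8 * lipbar * B * ((1 + cr * aA) * (cQa + cQb))) :
    TermSize (EreOf G act (fun U => weightOf (D U).toC.frame (D U).κ₁ d0 O1 ((D U).Kp cdir + (K U).Kp cK w0 c0 c1)) U₀ explZ base
        (fun U => cpieceChannel (D U).toC + cpieceChannel (K U).toC) (fun U => margProj (r U) (A U)) pt) W κ N ∧
      NE9 (EreOf G act (fun U => weightOf (D U).toC.frame (D U).κ₁ d0 O1 ((D U).Kp cdir + (K U).Kp cK w0 c0 c1)) U₀ explZ base
        (fun U => cpieceChannel (D U).toC + cpieceChannel (K U).toC) (fun U => margProj (r U) (A U)) pt) W κ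
        (prodModuli (8 * clipbar * B + 8 * lipbar * B * qTbar) fun _ => ω + 8 * lipbar * B * ((1 + cr * aA) * (cQa + cQb))) ∧
        FadingMemory ((8 * clipbar * B + 8 * lipbar * B * qTbar) / (ω + 8 * lipbar * B * ((1 + cr * aA) * (cQa + cQb))))
          (ω + 8 * lipbar * B * ((1 + cr * aA) * (cQa + cQb)))
          (prodModuli (8 * clipbar * B + 8 * lipbar * B * qTbar)
            fun _ => ω + 8 * lipbar * B * ((1 + cr * aA) * (cQa + cQb))) :=
  termSize_ne9_fading_re_of_chartFamily (C := C₀) (Ec := fun _ : Bg => E)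
    (fun U => EfOf G (act U) (weightOf (D U).toC.frame (D U).κ₁ d0 O1 ((D U).Kp cdir + (K U).Kp cK w0 c0 c1)) (U₀ U) (explZ U)
      (base U) (cpieceChannel (D U).toC + cpieceChannel (K U).toC) (margProj (r U) (A U)))
    pt U₁ (fun _ _ _ => rfl) fun U =>
      termSize_ne9_and_fadingMemory_endApplied G (hD U) hℓ (hLa U) (hAa U) hclipa hcdir hhalf (hcont U) (hlip U) (hroom U) (hK U)
        (hκ₁ U) (hR U) (hdY U) (hLb U) (hAb U) hlam (hkerC U) (hkerL U) hO1 hcQa hcQb (hMF U) (U₀ U) (explZ U) (base U) (hAdm U)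
        (hres U) (hrA U) (hr0 U) (hrs U) (hA U) hcr haA (hPinto U) hclip0 (hCup U) hclipb hNb hqTb (hKP U) hdec hpin (hwt U)
        (hexplZ U) (hbase0 U) hNsucc hNnn hB hlipb hω hω1 hpos

end Summit.QuantumFields.BalabanUV.T4Continuum.NE9EndAppliedRealRow

end
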